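import Summits.QuantumFields.YangMills.Theorems.BalabanUVNodesPortU8IotaC2Transport
import Summits.QuantumFields.YangMills.Theorems.BalabanUVNodesK0PortChart44DAtRecord
import Summits.QuantumFields.YangMills.Theorems.BalabanUVNodesPortS1Spaces
import Summits.QuantumFields.YangMills.Theorems.BalabanUVNodesK0RecordFormatNamesAx
import Literature.MathematicalPhysics.QuantumFieldTheory.Balaban1983to89.B12FormatPlus

/-!
# NODE O port, row PT-A-2 S4 — THE DISPLAYED SMOOTHNESS ROW DISCHARGED BY THE ITEM's OWN CONSEQUENT: `FORMAT⁺ᴳ` at level `k` ((1.6)–(1.7) representation +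
# (1.9)∕(1.18) analyticity of the pieces) + the signed token [12] (real-analyticity of `B ↦ U_{k+1}(W_B)` at `0`) ⟹ the record's chart `B ↦ 𝓝_{k+1}(exp ρ₈B)` is `C^N`
# at `0` for every `N` — the hypothesis `hC2 ∕ hC3 ∕ hC4` of FILES `…Sect5*`, `…Sect4WardSecondAtRecord`, `…Sect4WTReductionAtRecord` inside Theorem 3's induction on the scale

CITATION HEADER.  [I] = [Balaban1987RG1]: (1.6)–(1.7), (1.9) p. 261, (1.18)–(1.19) p. 263, (1.20) p. 264 («analytic function of B»), (4.35) p. 290; [15] = [Balaban1985Variational]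
Prop. 9 p. 309 (analytic dependence of the minimiser on the boundary data — the signed token [12]).  Porter PT-A-2 (`ymgap-nodeO-port-PTA-2`), `--supports stmt-QuantumFields-27930
--as helper`.  REUSED BY NAME: `PortU8.{contDiff_sl2Coord, contDiff_star', contDiffAt_current, coe_recordBgUnits_inv, contDiffAt_matrix_of_entries_analyticAt}` (FILE `…PortU8IotaC2Transport`,
whose `contDiffAt_recordEmbJ_of` is the `C²` case of §1), `K0PortChart44DAtRecord.analyticAt_recordChartJ` (the two-block chart is entire), `…PortS1Spaces.recordChartJ_recordEmbJ_zero_mem_recordUc`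
(the chart origin lies in every record space), `recordBgField_zero`, `MatrixLog.analyticAt_mlog`.
WHY.  In the closing induction of [I] Thm 3 (`…PortS1ResidueW.sig27930v8LR4_of_inductiveStepW`) the §4–§5 identities are used for the EARLIER functionals `𝓝_{j+1}`, `j ≤ k`, whose
FORMAT⁺ᴳ is the induction hypothesis; this file turns that hypothesis (+ token [12]) into the `C^N`-smoothness of the chart every §4–§5 file of this seat displays — so that row
is no longer an extra assumption on the port's road.
WHAT IS PROVED (0 sorry, 0 def).
* §1 `contDiffAt_recordEmbJ_of_contDiffAt` (any `N`; the `C²` proof of FILE `…PortU8IotaC2Transport` verbatim with `2 ↦ N`), `contDiffAt_recordEmbJ_of_analyticAt` (from the SHAPE of token [12]).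
* §2 `recordΦfAx_apply_eq_coe_expChart` (`rfl`), `expChart_recordTermsAx_eq_re`.
* §3 ★ `contDiffAt_of_eventuallyEq_sum_analytic` (generic: a germ identity `Φ = Σ_X E_X ∘ χ_X ∘ ι` near `0` with `E_X`, `χ_X` complex-analytic at the relevant points and `ι` `C^N`
  at `0` makes `Φ` `C^N` at `0`), ★★★ `contDiffAt_expChart_recordTermsAx_of_formatPlusG` (FORMAT⁺ᴳ at the record's twelve name families, level `k`, radii `α₀, α₁ > 0`, + token-[12]
  shape ⟹ `∀ n N, ContDiffAt ℝ N (expChart (recordTermsAx F a₀ ε₂₉ k v (recordK₀ F Mc k + n)) θ.ρ8) 0`).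
* §4 (v2) ★★ `eventually_contDiffAt_expChart_recordTermsAx_of_formatPlusG` — the same `∀ᶠ K in atTop` (the literal `hC2` row of `…Sect5AtRecord.sect5_recordPlimAx_of_rows₂`).
HONEST FRAMING.  Plumbing (composition of analytic∕smooth maps + a germ identity); nothing of Bałaban's estimates asserted, ported or discharged; FORMAT⁺ᴳ and token [12] are
HYPOTHESES here; 27930 signed-open (⁸-Ax-LR4), no claim held; finite 𝕋⁴ at fixed ε — NOT continuum∕OS∕Clay; the Yang–Mills mass gap is NOT proved by any of this.
-/

noncomputable section

open scoped Matrix.Norms.L2Operator Topology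

namespace Summit.QuantumFields.YangMills.Theorems.BalabanUVNodesPortS1

open Filter
open NormedSpace (exp)
open Literature.MathematicalPhysics.QuantumFieldTheory.Balaban1983to89
open Literature.MathematicalPhysics.QuantumFieldTheory.Balaban1983to89.Node00
open T4Continuum (T4Family)
open Summit.QuantumFields.YangMills.Theorems.K0RecordFormatNames
open Summit.QuantumFields.YangMills.Theorems.PortU8 (contDiff_sl2Coord contDiff_star' contDiffAt_current coe_recordBgUnits_inv contDiffAt_matrix_of_entries_analyticAt)
open Summit.QuantumFields.YangMills.Theorems.K0PortChart44DAtRecord (analyticAt_recordChartJ)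
open Literature.MathematicalPhysics.QuantumFieldTheory.Balaban1983to89.B12PolarizationTensor120 (expChart expChart_apply)

variable (F : T4Family)

/-! ## §1  The two-block coordinate embedding is `C^N` at `0` whenever the background field is (any `N`) -/

/-- **`C^N` transport for the coordinate embedding** (FILE `…PortU8IotaC2Transport`'s `contDiffAt_recordEmbJ_of` with `2 ↦ N`): if `B ↦ U_{k+1}(W_B)` (read in `M₂(ℂ)`, bondwise) is
`C^N` at `B = 0`, so is `recordEmbJ F θ k K` (standing range `k + 1 ≤ m + K`; any regularity radius, `UkSel_one`). [cite: Balaban1987RG1, (4.35) p.290, (1.8)–(1.9) p.261; Balaban1985Variational, Prop. 9 p.309] -/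
theorem contDiffAt_recordEmbJ_of_contDiffAt (θ : Stage13Params F 2) {N : WithTop ℕ∞} (k K : ℕ) (hk : k + 1 ≤ (F.P K).m + (F.P K).K)
    (hU : letI := θ.instVβ₁; letI := θ.instVβ₂;
      ContDiffAt ℝ N (fun B : Fin (F.P K).d → Site (F.P K) (k + 1) → θ.Vβ => fun b : PBond (F.P K) 0 => ((recordBgField F θ k K B b : SU 2) : MatA 2)) 0) :
    letI := θ.instVβ₁; letI := θ.instVβ₂; ContDiffAt ℝ N (recordEmbJ F θ k K) 0 := by
  letI := θ.instVβ₁; letI := θ.instVβ₂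
  have hb : ∀ b, ContDiffAt ℝ N (fun B : Fin (F.P K).d → Site (F.P K) (k + 1) → θ.Vβ => ((recordBgField F θ k K B b : SU 2) : MatA 2)) 0 :=
    fun b => contDiffAt_pi.1 hU b
  have hW : ∀ b, ContDiffAt ℝ N (fun B : Fin (F.P K).d → Site (F.P K) (k + 1) → θ.Vβ => ((recordBgUnits F θ k K B b : (MatA 2)ˣ) : MatA 2)) 0 := hb
  have hW' : ∀ b, ContDiffAt ℝ N (fun B : Fin (F.P K).d → Site (F.P K) (k + 1) → θ.Vβ => (((recordBgUnits F θ k K B b)⁻¹ : (MatA 2)ˣ) : MatA 2)) 0 := by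
    intro b
    simp only [coe_recordBgUnits_inv]
    exact contDiff_star'.contDiffAt.comp 0 (hb b)
  have hlog : ∀ b (a : Fin 3), ContDiffAt ℝ N (fun B : Fin (F.P K).d → Site (F.P K) (k + 1) → θ.Vβ =>
      sl2Coord (MatrixLog.mlog ((recordBgField F θ k K B b : SU 2) : MatA 2)) a) 0 := by
    intro b a
    have h0 : ((recordBgField F θ k K 0 b : SU 2) : MatA 2) = 1 := by
      rw [recordBgField_zero F θ hk]; rfl
    have hm : ContDiffAt ℝ N (MatrixLog.mlog : MatA 2 → MatA 2) ((recordBgField F θ k K 0 b : SU 2) : MatA 2) := by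
      rw [h0]
      exact ((MatrixLog.analyticAt_mlog (by simp)).restrictScalars (𝕜 := ℝ)).contDiffAt
    exact ContDiffAt.comp (g := fun A : MatA 2 => sl2Coord A a) 0 (contDiff_sl2Coord a).contDiffAt
      (ContDiffAt.comp (g := (MatrixLog.mlog : MatA 2 → MatA 2))
        (f := fun B : Fin (F.P K).d → Site (F.P K) (k + 1) → θ.Vβ => ((recordBgField F θ k K B b : SU 2) : MatA 2)) 0 hm (hb b))
  have hcur : ∀ b (a : Fin 3), ContDiffAt ℝ N (fun B : Fin (F.P K).d → Site (F.P K) (k + 1) → θ.Vβ => sl2Coord (recordCurrent F θ k K B b) a) 0 := by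
    intro b a
    exact ContDiffAt.comp (g := fun A : MatA 2 => sl2Coord A a) 0 (contDiff_sl2Coord a).contDiffAt
      (contDiffAt_current hW hW' sl2Proj ((F.P K).eta (k + 1)) b)
  rw [contDiffAt_pi]
  intro i
  obtain ⟨⟨b, t⟩, rfl⟩ := (chartEquivJ F K).surjective i
  rcases t with a | a
  · simpa [recordEmbJ] using hlog b a
  · simpa [recordEmbJ] using hcur b a

/-- **From the SHAPE of the signed token [12]** (entrywise real-analyticity at `B = 0` of `B ↦ U_{k+1}(W_B)` at `θ := thetaFill F a₀ ε₂₉`, volume `recordK₀ F Mc k + n`): the coordinate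
embedding `recordEmbJ` is `C^N` at `0` for every `N`. [cite: Balaban1985Variational, Prop. 9 p.309; Balaban1987RG1, (4.35) p.290] -/
theorem contDiffAt_recordEmbJ_of_analyticAt (a₀ ε₂₉ : ℝ) (Mc k n : ℕ) {N : WithTop ℕ∞}
    (hreg : letI θ := thetaFill F a₀ ε₂₉; letI := θ.instVβ₁; letI := θ.instVβ₂; letI := θ.instιβ;
      AnalyticAt ℝ (fun B : recordW F a₀ ε₂₉ k (recordK₀ F Mc k + n) =>
        fun (b : PBond (F.P (recordK₀ F Mc k + n)) 0) (i i' : Fin 2) =>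
          ((recordBgField F θ k (recordK₀ F Mc k + n) B b : SU 2) : Matrix (Fin 2) (Fin 2) ℂ) i i') 0) :
    letI θ := thetaFill F a₀ ε₂₉; letI := θ.instVβ₁; letI := θ.instVβ₂;
    ContDiffAt ℝ N (recordEmbJ F θ k (recordK₀ F Mc k + n)) 0 := by
  letI := (thetaFill F a₀ ε₂₉).instVβ₁; letI := (thetaFill F a₀ ε₂₉).instVβ₂
  exact contDiffAt_recordEmbJ_of_contDiffAt F (thetaFill F a₀ ε₂₉) k (recordK₀ F Mc k + n) (by simp only [T4Family.P_m, T4Family.P_K, recordK₀]; omega)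
    (contDiffAt_matrix_of_entries_analyticAt hreg)

/-! ## §2  `Φf` is the complexified chart -/

/-- `recordΦfAx … B = ↑(expChart (recordTermsAx …) ρ₈ B)` (definitional). [cite: Balaban1987RG1, (1.6) p.261, (1.20) p.264] -/
theorem recordΦfAx_apply_eq_coe_expChart (a₀ ε₂₉ : ℝ) (k : ℕ) (v : Fin (k + 1) → ℝ) (K : ℕ) (B : recordW F a₀ ε₂₉ k K) :
    letI θ := thetaFill F a₀ ε₂₉; letI := θ.instVβ₁; letI := θ.instVβ₂
    recordΦfAx F a₀ ε₂₉ k v K B = ((expChart (recordTermsAx F a₀ ε₂₉ k v K) θ.ρ8 B : ℝ) : ℂ) := rfl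

/-- The record's chart is the real part of `Φf`: `expChart (recordTermsAx …) ρ₈ B = Re (recordΦfAx … B)`. [cite: Balaban1987RG1, (1.6) p.261, (1.20) p.264] -/
theorem expChart_recordTermsAx_eq_re (a₀ ε₂₉ : ℝ) (k : ℕ) (v : Fin (k + 1) → ℝ) (K : ℕ) :
    letI θ := thetaFill F a₀ ε₂₉; letI := θ.instVβ₁; letI := θ.instVβ₂
    expChart (recordTermsAx F a₀ ε₂₉ k v K) θ.ρ8 = fun B => (recordΦfAx F a₀ ε₂₉ k v K B).re := by
  funext B
  rw [recordΦfAx_apply_eq_coe_expChart, Complex.ofReal_re]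

/-! ## §3  A germ identity `Φ = Σ_X E_X ∘ χ_X ∘ ι` with analytic `E_X, χ_X` and `C^N` `ι` makes `Φ` `C^N`; the record instance from FORMAT⁺ᴳ -/

/-- **★ Generic**: if `Φ B = Σ_{X} E_X(χ_X(ι B))` for `B` near `0` (finite index set), each `E_X` is complex-analytic at `χ_X(ι 0)`, each `χ_X` complex-analytic at `ι 0`, and `ι` is
`C^N` at `0` over ℝ, then `Φ` is `C^N` at `0` over ℝ. [cite: Balaban1987RG1, (1.7) p.261 with (1.9) p.261 and (1.20) p.264] -/
theorem contDiffAt_of_eventuallyEq_sum_analytic {W : Type*} [NormedAddCommGroup W] [NormedSpace ℝ W] {D : Type*} [Fintype D] {m M : ℕ}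
    {Φ : W → ℂ} {E : D → (Fin M → ℂ) → ℂ} {χ : D → (Fin m → ℂ) → (Fin M → ℂ)} {ι : W → (Fin m → ℂ)} {N : WithTop ℕ∞}
    (hR : ∀ᶠ B in 𝓝 (0 : W), Φ B = ∑ X, E X (χ X (ι B))) (hE : ∀ X, AnalyticAt ℂ (E X) (χ X (ι 0))) (hχ : ∀ X, AnalyticAt ℂ (χ X) (ι 0))
    (hι : ContDiffAt ℝ N ι 0) : ContDiffAt ℝ N Φ 0 := by
  have hsum : ContDiffAt ℝ N (fun B => ∑ X, E X (χ X (ι B))) 0 := by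
    refine ContDiffAt.sum fun X _ => ?_
    have hc : AnalyticAt ℂ (fun w => E X (χ X w)) (ι 0) := (hE X).comp (hχ X)
    exact (hc.restrictScalars (𝕜 := ℝ)).contDiffAt.comp 0 hι
  exact hsum.congr_of_eventuallyEq hR

/-- **★★★ FORMAT⁺ᴳ AT LEVEL `k` + TOKEN [12] ⟹ THE RECORD's CHART IS `C^N` AT `0`, EVERY `N`, EVERY VOLUME `recordK₀ F Mc k + n`** — the smoothness row displayed by this seat's §4–§5 files
(`hC2∕hC3∕hC4`), from the item's own consequent at level `k` (the induction hypothesis in Thm 3's induction) and the signed analyticity token: by (1.7) `Φf = Σ_X 𝐄(X) ∘ χ_X ∘ ι` near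
`0`, (1.9)∕(1.18) analyticity of the pieces on `recordUc … X` ∋ `χ_X(ι 0)` (`recordChartJ_recordEmbJ_zero_mem_recordUc`), the chart `recordChartJ` entire, and `ι = recordEmbJ` `C^N` (§1).
[cite: Balaban1987RG1, (1.6)–(1.7) p.261, (1.9) p.261, (1.18) p.263, (1.20) p.264; Balaban1985Variational, Prop. 9 p.309] -/
theorem contDiffAt_expChart_recordTermsAx_of_formatPlusG (a₀ ε₂₉ : ℝ) (Mc k : ℕ) (v : Fin (k + 1) → ℝ) {α₀ α₁ E₀ κ : ℝ}
    (hα₀ : 0 < α₀) (hα₁ : 0 < α₁)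
    (hF : letI θ := thetaFill F a₀ ε₂₉; letI := θ.instVβ₁; letI := θ.instVβ₂; letI := θ.instιβ;
      B12FormatPlus.FormatPlusG (fun n => recordDomSys F Mc k (recordK₀ F Mc k + n)) (fun n => recordBondCount F (recordK₀ F Mc k + n))
        (fun n => recordAct F (recordK₀ F Mc k + n)) (fun n => recordUc F Mc k α₀ α₁ (recordK₀ F Mc k + n)) (fun n => recordCoords F Mc k (recordK₀ F Mc k + n))
        (fun n => recordChartDimJ F (recordK₀ F Mc k + n)) (fun n => recordChartJ F Mc k (recordK₀ F Mc k + n))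
        (fun n => recordΦfAx F a₀ ε₂₉ k v (recordK₀ F Mc k + n)) (fun n => recordEmbJ F θ k (recordK₀ F Mc k + n))
        (fun n => recordWrapCtr F Mc k (recordK₀ F Mc k + n)) (fun n => recordDomEmbCtr F Mc k (recordK₀ F Mc k + n))
        (fun n _ => recordCoordProjCtr F (recordK₀ F Mc k + n)) E₀ κ)
    (hreg : letI θ := thetaFill F a₀ ε₂₉; letI := θ.instVβ₁; letI := θ.instVβ₂; letI := θ.instιβ;
      ∀ n : ℕ, AnalyticAt ℝ (fun B : recordW F a₀ ε₂₉ k (recordK₀ F Mc k + n) =>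
        fun (b : PBond (F.P (recordK₀ F Mc k + n)) 0) (i i' : Fin 2) =>
          ((recordBgField F θ k (recordK₀ F Mc k + n) B b : SU 2) : Matrix (Fin 2) (Fin 2) ℂ) i i') 0)
    (n : ℕ) (N : WithTop ℕ∞) :
    letI θ := thetaFill F a₀ ε₂₉; letI := θ.instVβ₁; letI := θ.instVβ₂
    ContDiffAt ℝ N (expChart (recordTermsAx F a₀ ε₂₉ k v (recordK₀ F Mc k + n)) θ.ρ8) 0 := by
  letI θ := thetaFill F a₀ ε₂₉; letI := θ.instVβ₁; letI := θ.instVβ₂; letI := θ.instιβ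
  obtain ⟨E, hA, -, -, hR, -, -⟩ := hF
  have hk : k + 1 ≤ (F.P (recordK₀ F Mc k + n)).m + (F.P (recordK₀ F Mc k + n)).K := by
    simp only [T4Family.P_m, T4Family.P_K, recordK₀]; omega
  have hΦ : ContDiffAt ℝ N (recordΦfAx F a₀ ε₂₉ k v (recordK₀ F Mc k + n)) 0 :=
    contDiffAt_of_eventuallyEq_sum_analytic (hR n)
      (fun X => hA n X _ (recordChartJ_recordEmbJ_zero_mem_recordUc F θ Mc hk X X hα₀ hα₁))
      (fun X => analyticAt_recordChartJ F Mc k (recordK₀ F Mc k + n) X _)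
      (contDiffAt_recordEmbJ_of_analyticAt F a₀ ε₂₉ Mc k n (hreg n))
  rw [expChart_recordTermsAx_eq_re]
  exact Complex.reCLM.contDiff.contDiffAt.comp 0 hΦ

/-! ## §4 (v2 APPEND)  The same EVENTUALLY IN THE VOLUME — the exact shape of the `hC2` row of FILE `…Sect5AtRecord.sect5_recordPlimAx_of_rows₂` (`∀ᶠ K in atTop, …`) -/

/-- **★★ FORMAT⁺ᴳ at level `k` + token [12] ⟹ `∀ᶠ K in atTop, C^N` of the record's chart at `0`**: every volume `K ≥ recordK₀ F Mc k` is `recordK₀ F Mc k + n`, so §3 gives the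
displayed row of `…Sect5AtRecord.sect5_recordPlimAx_of_rows₂` ∕ `…Sect5ChartSymmetry` ∕ `…Sect5Ward` in its literal `atTop` shape.
[cite: Balaban1987RG1, (1.6)–(1.7) p.261, (1.18) p.263, (1.20)–(1.21) p.264; Balaban1985Variational, Prop. 9 p.309] -/
theorem eventually_contDiffAt_expChart_recordTermsAx_of_formatPlusG (a₀ ε₂₉ : ℝ) (Mc k : ℕ) (v : Fin (k + 1) → ℝ) {α₀ α₁ E₀ κ : ℝ}
    (hα₀ : 0 < α₀) (hα₁ : 0 < α₁)
    (hF : letI θ := thetaFill F a₀ ε₂₉; letI := θ.instVβ₁; letI := θ.instVβ₂; letI := θ.instιβ;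
      B12FormatPlus.FormatPlusG (fun n => recordDomSys F Mc k (recordK₀ F Mc k + n)) (fun n => recordBondCount F (recordK₀ F Mc k + n))
        (fun n => recordAct F (recordK₀ F Mc k + n)) (fun n => recordUc F Mc k α₀ α₁ (recordK₀ F Mc k + n)) (fun n => recordCoords F Mc k (recordK₀ F Mc k + n))
        (fun n => recordChartDimJ F (recordK₀ F Mc k + n)) (fun n => recordChartJ F Mc k (recordK₀ F Mc k + n))
        (fun n => recordΦfAx F a₀ ε₂₉ k v (recordK₀ F Mc k + n)) (fun n => recordEmbJ F θ k (recordK₀ F Mc k + n))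
        (fun n => recordWrapCtr F Mc k (recordK₀ F Mc k + n)) (fun n => recordDomEmbCtr F Mc k (recordK₀ F Mc k + n))
        (fun n _ => recordCoordProjCtr F (recordK₀ F Mc k + n)) E₀ κ)
    (hreg : letI θ := thetaFill F a₀ ε₂₉; letI := θ.instVβ₁; letI := θ.instVβ₂; letI := θ.instιβ;
      ∀ n : ℕ, AnalyticAt ℝ (fun B : recordW F a₀ ε₂₉ k (recordK₀ F Mc k + n) =>
        fun (b : PBond (F.P (recordK₀ F Mc k + n)) 0) (i i' : Fin 2) =>
          ((recordBgField F θ k (recordK₀ F Mc k + n) B b : SU 2) : Matrix (Fin 2) (Fin 2) ℂ) i i') 0)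
    (N : WithTop ℕ∞) :
    letI θ := thetaFill F a₀ ε₂₉; letI := θ.instVβ₁; letI := θ.instVβ₂
    ∀ᶠ K in atTop, ContDiffAt ℝ N (expChart (recordTermsAx F a₀ ε₂₉ k v K) θ.ρ8) 0 := by
  letI θ := thetaFill F a₀ ε₂₉; letI := θ.instVβ₁; letI := θ.instVβ₂; letI := θ.instιβ
  refine Filter.eventually_atTop.2 ⟨recordK₀ F Mc k, fun K hK => ?_⟩
  obtain ⟨n, rfl⟩ := Nat.exists_eq_add_of_le hK
  exact contDiffAt_expChart_recordTermsAx_of_formatPlusG F a₀ ε₂₉ Mc k v hα₀ hα₁ hF hreg n N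

end Summit.QuantumFields.YangMills.Theorems.BalabanUVNodesPortS1

end
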